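import Literature.NumberTheory.Automorphic.CongruenceSubgroupExpansionGL
import Literature.NumberTheory.Automorphic.CongruenceKernelIwahori
import Literature.NumberTheory.Automorphic.IwasawaDecompositionGL
import Literature.NumberTheory.Automorphic.ParabolicInductionSupercuspidalProofs
import Literature.NumberTheory.Automorphic.ParabolicInductionLeviCartanProofs
import Literature.NumberTheory.Automorphic.SmoothInductionBigCell
import HarnessLib

/-!
# The big-cell datum of a standard parabolic subgroup of `GL_n(F)`

For a non-archimedean local field `F` and a monotone block labelling `c : Fin n → Fin r`, the
standard parabolic `P_c ≤ GL_n(F)` carries a `Representation.BigCellDatum`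
(`SmoothInductionBigCell`): `Literature.NumberTheory.Automorphic.bigCellDatumGL F c hϖ`, built
from an element `ϖ` with `0 < |ϖ| < 1`, with

* opposite radical `Ū = U_c⁻ = unipotentRadicalGL F (toDual ∘ c)` (block lower unitriangular;
  closed, `P_c ∩ U_c⁻ = 1`), Levi `M = standardLeviGL F c` (block diagonal, normalises `U_c⁻`);
* `K₀ = GL_n(𝒪)` (`glInt`), Iwasawa decomposition `GL_n(F) = P_c · GL_n(𝒪)` (from
  `exists_borel_mul_glInt` and `B ≤ P_c` for monotone `c`);
* `K j = congruenceGL n |ϖ|^(j+1)`, the principal congruence subgroups: compact open, a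
  neighbourhood basis of `1`, normalised by `GL_n(𝒪)` (the tree's `conj_mem_congruenceGL` of
  `CongruenceSubgroupExpansionGL`), with the
  two-factor **Iwahori factorisation** `K j = (P_c ∩ K j)(U_c⁻ ∩ K j)`
  (`exists_parabolic_mul_lower_of_mem_congruenceGL`, transported from the commutative-algebra
  statement `CongruenceKernel.exists_unipotent_mul_lower` over `𝒪` with the ideal
  `Valuation.leIdeal (valuation F) γ = {a : |a| ≤ γ}`);
* contracting elements `Z = {diag(ϖ^{g c(i)}) : g ∈ ℕ}` (block scalars, central in `M`):
  `(m t)(U_c⁻ ∩ K j)(m t)⁻¹ ⊆ K j'` for `t = diag(ϖ^{g c(i)})` with `g` large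
  (`exists_conj_lower_congruenceGL_subset`), since conjugation by `t` multiplies the entry
  `(i, j)` below the block diagonal by `ϖ^{g (c i - c j)}`, `c i - c j ≥ 1`.

These are Bernstein–Zelevinsky 1976, §3.1–3.3 / Casselman 1995, Prop. 1.4.3–1.4.4 for `GL_n`.
One definition, the datum `bigCellDatumGL` (the ideal `{a : |a| ≤ γ}` is Mathlib's `Valuation.leIdeal`);
theorems otherwise; no named facts.

## References

* I. N. Bernstein, A. V. Zelevinsky, *Representations of the group `GL(n, F)` where `F` is a
  non-archimedean local field*, Russian Math. Surveys 31:3 (1976), §3.1–3.3, §3.13.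
* W. Casselman, *Introduction to the theory of admissible representations of `p`-adic reductive
  groups* (1995 notes), Prop. 1.4.3, Prop. 1.4.4.
-/

noncomputable section

open scoped MatrixGroups Pointwise
open Matrix ValuativeRel OrderDual Topology

namespace Literature.NumberTheory.Automorphic

/-! ### `P_c ∩ U_c⁻ = 1`, the Levi normalises `U_c⁻`, `B ≤ P_c` -/

section Algebra

variable {R : Type*} [CommRing R] {n : Type*} [Fintype n] [DecidableEq n] {α : Type*}
  [LinearOrder α] (c : n → α)

/-- `P_c ∩ U_c⁻ = 1`: a block upper triangular matrix which is block lower unitriangular is the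
identity. [folklore] -/
theorem eq_one_of_mem_standardParabolicGL_of_mem_lower {g : GL n R}
    (hP : g ∈ standardParabolicGL R c) (hU : g ∈ unipotentRadicalGL R (⇑toDual ∘ c)) : g = 1 := by
  refine Units.ext (Matrix.ext fun i j => ?_)
  rw [mem_unipotentRadicalGL_iff_apply] at hU
  rcases lt_or_ge (c j) (c i) with h | h
  · rw [(mem_standardParabolicGL_iff c g).1 hP h, Units.val_one, Matrix.one_apply_ne]
    rintro rfl
    exact lt_irrefl _ h
  · exact hU i j h

/-- Block diagonal matrices are block triangular for the dual order as well. [folklore] -/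
theorem blockDiagonalGL_mem_dual [Fintype α] (m : Π a, GL {i // c i = a} R) :
    blockDiagonalGL R c m ∈ standardParabolicGL R (⇑toDual ∘ c) := by
  intro i j hij
  rw [blockDiagonalGL_apply_coe, Matrix.blockDiagonal'_apply_ne]
  exact fun h => (toDual_lt_toDual.1 hij).ne h

/-- **The Levi normalises the opposite radical**: `m u m⁻¹ ∈ U_c⁻` for `m ∈ M_c` block diagonal
and `u ∈ U_c⁻`. [folklore] -/
theorem conj_mem_lower_of_mem_standardLeviGL [Fintype α] {m u : GL n R}
    (hm : m ∈ standardLeviGL R c) (hu : u ∈ unipotentRadicalGL R (⇑toDual ∘ c)) :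
    m * u * m⁻¹ ∈ unipotentRadicalGL R (⇑toDual ∘ c) := by
  obtain ⟨g, rfl⟩ := hm
  change blockDiagonalGL R c g * u * (blockDiagonalGL R c g)⁻¹ ∈ _
  rw [← map_inv]
  have hmP := blockDiagonalGL_mem_dual c g
  have hmP' := blockDiagonalGL_mem_dual c g⁻¹
  rw [mem_unipotentRadicalGL_iff] at hu ⊢
  obtain ⟨huT, hu1⟩ := hu
  have hT : ((blockDiagonalGL R c g * u * blockDiagonalGL R c g⁻¹ : GL n R) : Matrix n n R).BlockTriangular
      (⇑toDual ∘ c) := by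
    rw [Units.val_mul, Units.val_mul]
    exact (hmP.mul huT).mul hmP'
  refine ⟨hT, fun a => ?_⟩
  rw [Units.val_mul, Units.val_mul, Matrix.BlockTriangular.toSquareBlock_mul (hmP.mul huT) hmP',
    Matrix.BlockTriangular.toSquareBlock_mul hmP huT, hu1 a, mul_one,
    ← Matrix.BlockTriangular.toSquareBlock_mul hmP hmP', ← Units.val_mul, ← map_mul,
    mul_inv_cancel, map_one, Units.val_one, Matrix.toSquareBlock_one]

/-- The Borel subgroup is contained in every standard parabolic of a monotone labelling of an
ordered index type. [folklore] -/
theorem borel_le_standardParabolicGL {n : Type*} [Fintype n] [DecidableEq n] [LinearOrder n]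
    {c : n → α} (hc : Monotone c) :
    standardParabolicGL R (_root_.id : n → n) ≤ standardParabolicGL R c := by
  intro b hb i j hij
  exact hb (lt_of_not_ge fun h => (hc h).not_gt hij)

end Algebra

/-! ### Principal congruence subgroups: normality in `GL_n(𝒪)` and Iwahori factorisation -/

section Congruence

variable {F : Type*} [Field F] [ValuativeRel F] {n : ℕ}

/-- For `γ < 1` the ideal `{|a| ≤ γ}` consists of non-units, hence lies in the Jacobson radical of
the local ring `𝒪`. [folklore] -/
theorem leIdeal_le_jacobson {γ : ValueGroupWithZero F} (hγ : γ < 1) :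
    Valuation.leIdeal (valuation F) γ ≤ Ideal.jacobson ⊥ := by
  rw [IsLocalRing.jacobson_eq_maximalIdeal ⊥ bot_ne_top]
  intro a ha
  rw [IsLocalRing.mem_maximalIdeal, mem_nonunits_iff]
  intro hu
  have h1 : valuation F (a : F) = 1 := (Valuation.Integers.isUnit_iff_valuation_eq_one
    (Valuation.integer.integers (valuation F))).1 hu
  have h2 : valuation F (a : F) ≤ γ := ha
  rw [h1] at h2
  exact lt_irrefl _ (h2.trans_lt hγ)

/-- An element of the congruence kernel of level `{|a| ≤ γ}` over `𝒪` maps into the principal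
congruence subgroup `K_γ` of `GL_n(F)`. [folklore] -/
theorem map_mem_congruenceGL_of_mem_congruenceKer {γ : ValueGroupWithZero F} {k : GL (Fin n) 𝒪[F]}
    (hk : k ∈ CongruenceKernel.congruenceKer (Valuation.leIdeal (valuation F) γ) (Fin n)) :
    Matrix.GeneralLinearGroup.map (𝒪[F]).subtype k ∈ congruenceGL n γ := by
  have hint : ∀ k' : GL (Fin n) 𝒪[F], ValBound 1
      ((Matrix.GeneralLinearGroup.map (𝒪[F]).subtype k' : GL (Fin n) F) : Matrix (Fin n) (Fin n) F) :=
    fun k' i j => (Valuation.mem_integer_iff _ _).1 ((k' : Matrix (Fin n) (Fin n) 𝒪[F]) i j).2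
  have hlev : ∀ k' : GL (Fin n) 𝒪[F], k' ∈ CongruenceKernel.congruenceKer (Valuation.leIdeal (valuation F) γ) (Fin n) →
      ValBound γ (((Matrix.GeneralLinearGroup.map (𝒪[F]).subtype k' : GL (Fin n) F) :
        Matrix (Fin n) (Fin n) F) - 1) := by
    intro k' hk' i j
    have h := (CongruenceKernel.mem_congruenceKer_iff k').1 hk' i j
    rw [Valuation.mem_leIdeal_iff] at h
    have e : (((Matrix.GeneralLinearGroup.map (𝒪[F]).subtype k' : GL (Fin n) F) :
        Matrix (Fin n) (Fin n) F) - 1) i j =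
        (((k' : Matrix (Fin n) (Fin n) 𝒪[F]) i j - (1 : Matrix (Fin n) (Fin n) 𝒪[F]) i j : 𝒪[F]) : F) := by
      rw [Matrix.sub_apply, Matrix.one_apply, Matrix.one_apply]
      split_ifs <;> simp
    rw [e]
    exact h
  refine ⟨⟨hint k, ?_⟩, hlev k hk, ?_⟩
  · rw [← map_inv]; exact hint k⁻¹
  · rw [← map_inv]; exact hlev k⁻¹ (Subgroup.inv_mem _ hk)

/-- Every element of `K_γ` comes from the congruence kernel of level `{|a| ≤ γ}` over `𝒪`
(`γ < 1`; its entries are integral and `≡ 1`, and such a matrix is invertible over `𝒪`). [folklore] -/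
theorem exists_map_eq_of_mem_congruenceGL {γ : ValueGroupWithZero F} (hγ : γ < 1) {x : GL (Fin n) F}
    (hx : x ∈ congruenceGL n γ) :
    ∃ k ∈ CongruenceKernel.congruenceKer (Valuation.leIdeal (valuation F) γ) (Fin n),
      Matrix.GeneralLinearGroup.map (𝒪[F]).subtype k = x := by
  set M : Matrix (Fin n) (Fin n) 𝒪[F] := fun i j =>
    ⟨(x : Matrix (Fin n) (Fin n) F) i j, (Valuation.mem_integer_iff _ _).2 (hx.1.1 i j)⟩ with hM
  have hMc : CongruenceKernel.IsCongOne (Valuation.leIdeal (valuation F) γ) M := by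
    intro i j
    rw [Valuation.mem_leIdeal_iff]
    have e : ((M i j - (1 : Matrix (Fin n) (Fin n) 𝒪[F]) i j : 𝒪[F]) : F) =
        ((x : Matrix (Fin n) (Fin n) F) - 1) i j := by
      rw [Matrix.sub_apply, Matrix.one_apply, Matrix.one_apply, hM]
      split_ifs <;> simp
    rw [e]
    exact hx.2.1 i j
  refine ⟨CongruenceKernel.unitOfIsCongOne (leIdeal_le_jacobson hγ) M hMc,
    CongruenceKernel.unitOfIsCongOne_mem _ M hMc, Units.ext (Matrix.ext fun i j => ?_)⟩
  simp [hM]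

/-- `GL_n` of a ring homomorphism preserves standard parabolics. [folklore] -/
theorem map_mem_standardParabolicGL {R S : Type*} [CommRing R] [CommRing S] (f : R →+* S)
    {m : Type*} [Fintype m] [DecidableEq m] {α : Type*} [LinearOrder α] (b : m → α) {g : GL m R}
    (hg : g ∈ standardParabolicGL R b) : Matrix.GeneralLinearGroup.map f g ∈ standardParabolicGL S b := by
  intro i j hij
  change f ((g : Matrix m m R) i j) = 0
  rw [hg hij, map_zero]

/-- `GL_n` of a ring homomorphism preserves unipotent radicals of standard parabolics. [folklore] -/
theorem map_mem_unipotentRadicalGL {R S : Type*} [CommRing R] [CommRing S] (f : R →+* S)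
    {m : Type*} [Fintype m] [DecidableEq m] {α : Type*} [LinearOrder α] (b : m → α) {g : GL m R}
    (hg : g ∈ unipotentRadicalGL R b) : Matrix.GeneralLinearGroup.map f g ∈ unipotentRadicalGL S b := by
  rw [mem_unipotentRadicalGL_iff_apply] at hg ⊢
  intro i j hij
  change f ((g : Matrix m m R) i j) = (1 : Matrix m m S) i j
  rw [hg i j hij, Matrix.one_apply, Matrix.one_apply]
  split_ifs <;> simp

/-- **Iwahori factorisation of the principal congruence subgroups of `GL_n(F)`** with respect to
a standard parabolic `P_c` and its opposite radical: for `γ < 1`, every `x ∈ K_γ` is `x = p u` with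
`p ∈ P_c ∩ K_γ` and `u ∈ U_c⁻ ∩ K_γ` (from `CongruenceKernel.exists_unipotent_mul_lower` applied
to `x⁻¹` and the dual labelling). (Bernstein–Zelevinsky 1976, §3.13; Casselman 1995, Prop. 1.4.4.)
[cite: BernsteinZelevinsky1976, §3.13] -/
theorem exists_parabolic_mul_lower_of_mem_congruenceGL {α : Type*} [LinearOrder α] (c : Fin n → α)
    {γ : ValueGroupWithZero F} (hγ : γ < 1) {x : GL (Fin n) F} (hx : x ∈ congruenceGL n γ) :
    ∃ p ∈ standardParabolicGL F c, p ∈ congruenceGL n γ ∧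
      ∃ u ∈ unipotentRadicalGL F (⇑toDual ∘ c), u ∈ congruenceGL n γ ∧ x = p * u := by
  obtain ⟨k, hk, hkx⟩ := exists_map_eq_of_mem_congruenceGL hγ (Subgroup.inv_mem _ hx)
  obtain ⟨u', hu'K, p', hp'K, hu'U, hp'P, hk'⟩ :=
    CongruenceKernel.exists_unipotent_mul_lower (leIdeal_le_jacobson hγ) (⇑toDual ∘ c) hk
  set f := Matrix.GeneralLinearGroup.map (n := Fin n) (𝒪[F]).subtype with hf
  refine ⟨f p'⁻¹, ?_, ?_, f u'⁻¹, ?_, ?_, ?_⟩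
  · have h := map_mem_standardParabolicGL (𝒪[F]).subtype (⇑toDual ∘ ⇑toDual ∘ c) (Subgroup.inv_mem _ hp'P)
    intro i j hij
    exact h hij
  · exact map_mem_congruenceGL_of_mem_congruenceKer (Subgroup.inv_mem _ hp'K)
  · exact map_mem_unipotentRadicalGL _ _ (Subgroup.inv_mem _ hu'U)
  · exact map_mem_congruenceGL_of_mem_congruenceKer (Subgroup.inv_mem _ hu'K)
  · rw [← map_mul, ← _root_.mul_inv_rev, ← hk', map_inv, hkx, inv_inv]

end Congruence

/-! ### Block-scalar torus elements: membership in the Levi and contraction of `U_c⁻` -/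

section Torus

variable {F : Type*} [Field F] {n r : ℕ} (c : Fin n → Fin r) {ϖ : F} (hϖ : ϖ ≠ 0)

/-- The block diagonal matrix of `diag(ϖ^e)` (Levi element) is the diagonal matrix `ϖ^e`. [folklore] -/
theorem blockDiagonalGL_leviZpowDiag (e : Fin n → ℤ) :
    blockDiagonalGL F c (leviZpowDiag c hϖ e) = zpowDiagGL hϖ e := by
  refine Units.ext (Matrix.ext fun i j => ?_)
  rw [blockDiagonalGL_apply_coe, coe_zpowDiagGL]
  by_cases hij : c j = c i
  · have : (⟨c j, ⟨j, rfl⟩⟩ : Σ a, {k // c k = a}) = ⟨c i, ⟨j, hij⟩⟩ := Sigma.subtype_ext hij rfl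
    rw [this, Matrix.blockDiagonal'_apply_eq, coe_leviZpowDiag_apply, Matrix.diagonal_apply,
      Matrix.diagonal_apply]
    by_cases h : i = j
    · subst h
      rw [if_pos rfl, if_pos rfl]
    · rw [if_neg (fun h' => h (congrArg Subtype.val h')), if_neg h]
  · rw [Matrix.blockDiagonal'_apply_ne _ _ _ (Ne.symm hij), Matrix.diagonal_apply_ne]
    rintro rfl
    exact hij rfl

/-- Diagonal matrices `ϖ^e` lie in the standard Levi `M_c`. [folklore] -/
theorem zpowDiagGL_mem_standardLeviGL (e : Fin n → ℤ) : zpowDiagGL hϖ e ∈ standardLeviGL F c :=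
  ⟨leviZpowDiag c hϖ e, by rw [leviEmbedding_apply, blockDiagonalGL_leviZpowDiag]⟩

variable [ValuativeRel F]

/-- Every matrix has entries of bounded valuation (finitely many entries). [folklore] -/
theorem exists_valBound (M : Matrix (Fin n) (Fin n) F) : ∃ C : ValueGroupWithZero F, ValBound C M :=
  ⟨Finset.univ.sup fun p : Fin n × Fin n => valuation F (M p.1 p.2), fun i j =>
    Finset.le_sup (f := fun p : Fin n × Fin n => valuation F (M p.1 p.2)) (Finset.mem_univ (i, j))⟩

/-- **Contraction of `U_c⁻ ∩ K_γ` by block-scalar torus elements.** For `u ∈ U_c⁻` with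
`u ≡ 1` within `γ`, the conjugate `t u t⁻¹`, `t = diag(ϖ^{g c(i)})`, is `≡ 1` within `|ϖ|^g γ`:
the entry `(i, j)` of `t u t⁻¹ - 1` is `ϖ^{g (c i - c j)} (u - 1)_{ij}`, which vanishes unless
`c j < c i`. (Casselman 1995, Prop. 1.4.3.) [cite: Casselman1995, Prop. 1.4.3] -/
theorem valBound_zpowDiagGL_conj_sub_one (hϖ1 : valuation F ϖ ≤ 1) (g : ℕ) {γ : ValueGroupWithZero F}
    {u : GL (Fin n) F} (hu : u ∈ unipotentRadicalGL F (⇑toDual ∘ c))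
    (huγ : ValBound γ ((u : Matrix (Fin n) (Fin n) F) - 1)) :
    ValBound (valuation F ϖ ^ g * γ)
      (((zpowDiagGL hϖ (fun i => (g : ℤ) * (c i : ℕ)) * u *
        (zpowDiagGL hϖ (fun i => (g : ℤ) * (c i : ℕ)))⁻¹ : GL (Fin n) F) : Matrix (Fin n) (Fin n) F) - 1) := by
  intro i j
  rw [coe_zpowDiagGL_mul_mul_inv_sub_one_apply, map_mul]
  rcases le_or_gt (c i) (c j) with h | h
  · -- on and above the block diagonal `u - 1` vanishes
    have h0 : ((u : Matrix (Fin n) (Fin n) F) - 1) i j = 0 := by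
      rw [Matrix.sub_apply, (mem_unipotentRadicalGL_iff_apply u).1 hu i j (toDual_le_toDual.2 h),
        sub_self]
    rw [h0, map_zero, mul_zero]
    exact zero_le
  · have hexp : (g : ℤ) ≤ (g : ℤ) * (c i : ℕ) - (g : ℤ) * (c j : ℕ) := by
      rw [← mul_sub]
      have : (1 : ℤ) ≤ (c i : ℕ) - (c j : ℕ) := by
        have := Fin.lt_def.1 h
        omega
      nlinarith
    obtain ⟨d, hd⟩ := Int.eq_ofNat_of_zero_le ((Int.natCast_nonneg g).trans hexp)
    rw [hd, zpow_natCast, map_pow]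
    refine mul_le_mul' (pow_le_pow_right_of_le_one' hϖ1 ?_) (huγ i j)
    exact_mod_cast hd ▸ hexp

/-- **Contracting elements for the big-cell datum**: for every `m ∈ GL_n(F)`, every bound `γ` and
every `δ ≠ 0`, `δ ≤ 1`, there is `g` such that `(m t) u (m t)⁻¹ ∈ K_δ` for all `u ∈ U_c⁻ ∩ K_γ`,
where `t = diag(ϖ^{g c(i)})` and `0 < |ϖ| < 1`. (Bernstein–Zelevinsky 1976, §3.3; Casselman 1995,
Prop. 1.4.3.) [cite: Casselman1995, Prop. 1.4.3] -/
theorem exists_conj_lower_mem_congruenceGL [TopologicalSpace F] [IsNonarchimedeanLocalField F]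
    (hϖ0 : valuation F ϖ ≠ 0) (hϖ1 : valuation F ϖ < 1) (m : GL (Fin n) F)
    (γ : ValueGroupWithZero F) {δ : ValueGroupWithZero F} (hδ : δ ≠ 0) (hδ1 : δ ≤ 1) :
    ∃ g : ℕ, ∀ u ∈ unipotentRadicalGL F (⇑toDual ∘ c), u ∈ congruenceGL n γ →
      m * zpowDiagGL hϖ (fun i => (g : ℤ) * (c i : ℕ)) * u *
        (m * zpowDiagGL hϖ (fun i => (g : ℤ) * (c i : ℕ)))⁻¹ ∈ congruenceGL n δ := by
  obtain ⟨C, hC⟩ := exists_valBound (m : Matrix (Fin n) (Fin n) F)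
  obtain ⟨C', hC'⟩ := exists_valBound ((m⁻¹ : GL (Fin n) F) : Matrix (Fin n) (Fin n) F)
  obtain ⟨g, hg⟩ := exists_pow_mul_le hϖ0 hϖ1 (C * γ * C') hδ
  refine ⟨g, fun u hu huγ => ?_⟩
  set t : GL (Fin n) F := zpowDiagGL hϖ (fun i => (g : ℤ) * (c i : ℕ)) with ht
  have hmm : (m : Matrix (Fin n) (Fin n) F) * ((m⁻¹ : GL (Fin n) F) : Matrix (Fin n) (Fin n) F) = 1 := by
    rw [← Units.val_mul, mul_inv_cancel, Units.val_one]
  -- the bound for a general `v ∈ U_c⁻ ∩ K_γ`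
  have key : ∀ v ∈ unipotentRadicalGL F (⇑toDual ∘ c), v ∈ congruenceGL n γ →
      ValBound δ (((m * t * v * (m * t)⁻¹ : GL (Fin n) F) : Matrix (Fin n) (Fin n) F) - 1) := by
    intro v hv hvγ
    have h1 := valBound_zpowDiagGL_conj_sub_one c hϖ hϖ1.le g hv hvγ.2.1
    rw [← ht] at h1
    have e : ((m * t * v * (m * t)⁻¹ : GL (Fin n) F) : Matrix (Fin n) (Fin n) F) - 1 =
        (m : Matrix (Fin n) (Fin n) F) * (((t * v * t⁻¹ : GL (Fin n) F) : Matrix (Fin n) (Fin n) F) - 1) *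
          ((m⁻¹ : GL (Fin n) F) : Matrix (Fin n) (Fin n) F) := by
      rw [show m * t * v * (m * t)⁻¹ = m * (t * v * t⁻¹) * m⁻¹ by group, Units.val_mul, Units.val_mul,
        Matrix.mul_sub, Matrix.mul_one, Matrix.sub_mul, hmm]
    rw [e]
    refine ((hC.mul h1).mul hC').mono ?_
    calc C * (valuation F ϖ ^ g * γ) * C' = valuation F ϖ ^ g * (C * γ * C') := by
          simp only [mul_assoc, mul_left_comm C]
      _ ≤ δ := hg
  have hinv : (m * t * u * (m * t)⁻¹)⁻¹ = m * t * u⁻¹ * (m * t)⁻¹ := by group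
  refine ⟨⟨?_, ?_⟩, key u hu huγ, ?_⟩
  · exact (key u hu huγ).of_sub_one hδ1
  · rw [hinv]
    exact (key u⁻¹ (Subgroup.inv_mem _ hu) (Subgroup.inv_mem _ huγ)).of_sub_one hδ1
  · rw [hinv]
    exact key u⁻¹ (Subgroup.inv_mem _ hu) (Subgroup.inv_mem _ huγ)

end Torus

/-! ### The datum -/

section Datum

variable (F : Type*) [Field F] [ValuativeRel F] {n r : ℕ}

/-- **Iwasawa decomposition for a standard parabolic**: `GL_n(F) = P_c · GL_n(𝒪)` for a monotone
block labelling `c` (from `GL_n(F) = B · GL_n(𝒪)`, `exists_borel_mul_glInt`, and `B ≤ P_c`).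
(Bernstein–Zelevinsky 1977, §2.3: "`G` is compact modulo `P`"; Bump 1997, Prop. 4.5.2.)
[cite: Bump1997, Prop. 4.5.2] -/
theorem exists_standardParabolicGL_mul_glInt {c : Fin n → Fin r} (hc : Monotone c) (g : GL (Fin n) F) :
    ∃ p ∈ standardParabolicGL F c, ∃ k ∈ glInt n F, g = p * k := by
  obtain ⟨b, hb, k, hk, hgk⟩ := exists_borel_mul_glInt g
  exact ⟨b, borel_le_standardParabolicGL hc hb, k, hk, hgk⟩

variable [TopologicalSpace F] [IsNonarchimedeanLocalField F]

/-- Unipotent radicals of standard parabolics are closed in `GL_n(F)` (entrywise equations); a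
private copy, for `GL (Fin n)` over a local field, of
`Literature.NumberTheory.Automorphic.isClosed_unipotentRadicalGL` of `UnipotentRadicalCompactOpenProofs`
(not imported: it carries the Whittaker/Siegel theory). [folklore] -/
private theorem isClosed_unipotentRadicalGL' {α : Type*} [LinearOrder α] (b : Fin n → α) :
    IsClosed (unipotentRadicalGL F b : Set (GL (Fin n) F)) := by
  haveI := (GaloisRepresentations.IsNonarchimedeanLocalField.isLocalField F).toT2Space
  have : (unipotentRadicalGL F b : Set (GL (Fin n) F)) =
      ⋂ i : Fin n, ⋂ j : Fin n,
        {g : GL (Fin n) F | b j ≤ b i → (g : Matrix (Fin n) (Fin n) F) i j = (1 : Matrix _ _ F) i j} := by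
    ext g
    simp only [SetLike.mem_coe, mem_unipotentRadicalGL_iff_apply, Set.mem_iInter, Set.mem_setOf_eq]
  rw [this]
  refine isClosed_iInter fun i => isClosed_iInter fun j => ?_
  by_cases hij : b j ≤ b i
  · simp only [hij, forall_true_left]
    exact isClosed_eq (Units.continuous_val.matrix_elem i j) continuous_const
  · simp [hij]

variable {F}

/-- **The big-cell datum of `P_c ≤ GL_n(F)`** for a monotone labelling `c : Fin n → Fin r` and an
element `ϖ` with `0 < |ϖ| < 1`: opposite radical `U_c⁻`, Levi `M_c`, `K₀ = GL_n(𝒪)` with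
`GL_n(F) = P_c GL_n(𝒪)`, principal congruence subgroups `K j = K_{|ϖ|^(j+1)}` (normalised by
`GL_n(𝒪)`, Iwahori factorisation `K j = (P_c ∩ K j)(U_c⁻ ∩ K j)`), and contracting block-scalar
torus elements `diag(ϖ^{g c(i)})`. (Bernstein–Zelevinsky 1976, §3.1–3.3, §3.13; Casselman 1995,
Prop. 1.4.3–1.4.4.) [cite: BernsteinZelevinsky1976, §3.13] -/
def bigCellDatumGL {c : Fin n → Fin r} (hc : Monotone c) {ϖ : F} (hϖ0 : valuation F ϖ ≠ 0)
    (hϖ1 : valuation F ϖ < 1) : Representation.BigCellDatum (standardParabolicGL F c) where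
  Ubar := unipotentRadicalGL F (⇑toDual ∘ c)
  isClosed_Ubar := isClosed_unipotentRadicalGL' F _
  eq_one_of_mem := fun _ hP hU => eq_one_of_mem_standardParabolicGL_of_mem_lower c hP hU
  M := standardLeviGL F c
  M_le := standardLeviGL_le F c
  conj_mem_Ubar := fun _ hm _ hu => conj_mem_lower_of_mem_standardLeviGL c hm hu
  K₀ := glInt n F
  isCompact_K₀ := isCompact_glInt n F
  exists_mul_eq := exists_standardParabolicGL_mul_glInt F hc
  K := fun j => congruenceGL n (valuation F ϖ ^ (j + 1))
  isOpen_K := fun j => isOpen_congruenceGL (pow_ne_zero _ hϖ0)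
  isCompact_K := fun j => isCompact_congruenceGL _
  exists_K_subset := fun U hU => by
    obtain ⟨γ, hγ⟩ := exists_congruenceGL_subset hU
    obtain ⟨d, hd⟩ := exists_pow_mul_le hϖ0 hϖ1 1 (δ := (γ : ValueGroupWithZero F)) γ.ne_zero
    refine ⟨d, Set.Subset.trans ?_ hγ⟩
    refine congruenceGL_mono ?_
    rw [mul_one] at hd
    exact (pow_le_pow_right_of_le_one' hϖ1.le (Nat.le_succ d)).trans hd
  conj_mem_K := fun _ _ hs _ hx => conj_mem_congruenceGL hs hx
  exists_factor := fun j x hx => by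
    obtain ⟨p, hpP, hpK, u, huU, huK, rfl⟩ := exists_parabolic_mul_lower_of_mem_congruenceGL c
      (pow_lt_one₀ zero_le hϖ1 (Nat.succ_ne_zero j)) hx
    exact ⟨p, hpP, hpK, u, huU, huK, rfl⟩
  Z := Set.range fun g : ℕ => zpowDiagGL ((Valuation.ne_zero_iff _).1 hϖ0) (fun i => (g : ℤ) * (c i : ℕ))
  Z_subset := by
    rintro _ ⟨g, rfl⟩
    exact zpowDiagGL_mem_standardLeviGL c _ _
  exists_contract := fun j j' m _ => by
    obtain ⟨g, hg⟩ := exists_conj_lower_mem_congruenceGL c ((Valuation.ne_zero_iff _).1 hϖ0) hϖ0 hϖ1 m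
      (valuation F ϖ ^ (j + 1)) (δ := valuation F ϖ ^ (j' + 1)) (pow_ne_zero _ hϖ0)
      (pow_le_one₀ zero_le hϖ1.le)
    exact ⟨_, ⟨g, rfl⟩, fun u hu huK => hg u hu huK⟩

/-- The subgroups `K j` of the datum are the principal congruence subgroups `K_{|ϖ|^(j+1)}`. [folklore] -/
@[simp] theorem bigCellDatumGL_K {c : Fin n → Fin r} (hc : Monotone c) {ϖ : F}
    (hϖ0 : valuation F ϖ ≠ 0) (hϖ1 : valuation F ϖ < 1) (j : ℕ) :
    (bigCellDatumGL hc hϖ0 hϖ1).K j = congruenceGL n (valuation F ϖ ^ (j + 1)) := rfl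

/-- The Levi of the datum is the standard Levi `M_c`. [folklore] -/
@[simp] theorem bigCellDatumGL_M {c : Fin n → Fin r} (hc : Monotone c) {ϖ : F}
    (hϖ0 : valuation F ϖ ≠ 0) (hϖ1 : valuation F ϖ < 1) : (bigCellDatumGL hc hϖ0 hϖ1).M = standardLeviGL F c := rfl

/-- The contracting elements of the datum are the block-scalar torus elements `diag(ϖ^{g c(i)})`. [folklore] -/
theorem mem_bigCellDatumGL_Z_iff {c : Fin n → Fin r} (hc : Monotone c) {ϖ : F}
    (hϖ0 : valuation F ϖ ≠ 0) (hϖ1 : valuation F ϖ < 1) {t : GL (Fin n) F} :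
    t ∈ (bigCellDatumGL hc hϖ0 hϖ1).Z ↔
      ∃ g : ℕ, zpowDiagGL ((Valuation.ne_zero_iff _).1 hϖ0) (fun i => (g : ℤ) * (c i : ℕ)) = t :=
  Iff.rfl

/-- **Existence of the parameter**: a non-archimedean local field has an element `ϖ` with
`0 < |ϖ| < 1`. [folklore] -/
theorem exists_valuation_pos_lt_one : ∃ ϖ : F, valuation F ϖ ≠ 0 ∧ valuation F ϖ < 1 := by
  obtain ⟨x, hx0, hx1⟩ := Valuation.IsNontrivial.exists_lt_one (v := valuation F)
  exact ⟨x, (Valuation.ne_zero_iff _).2 hx0, hx1⟩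

end Datum

end Literature.NumberTheory.Automorphic
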